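import Summits.RiemannHypothesis.RiemannHypothesis.Theorems.GroundBartaPolarPerronFrobeniusGapCertCore
import Summits.RiemannHypothesis.RiemannHypothesis.Theorems.GroundBartaEvenWinsBeyondArchDeflationCertBridgeWEven
import HarnessLib

/-!
# Gap certificates from deflated Temple data, II: `C²` × indicator Ritz data and the two-prime certificate bridge
(route `RiemannHypothesis/GroundBarta`, crux `PolarPerronFrobenius` = stmt-RiemannHypothesis-18390, helper; RH-free, no
definitions, no named facts, no sorry)

Continuation of `GroundBartaPolarPerronFrobeniusGapCertCore`: the two wrappers of the parity ladder's weighted chain,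
copied with the rank-one penalty `K |Σ_l c_l ∫ φ v̄_l|²` carried through and with the conclusion kept PER TEST (a gap
certificate is an inequality on every even window test, not a bound for the sector bottom).

* `gc_sector_bound_of_ritz_wK` — copy of `dt_sector_bound_of_ritz_w`: trial vectors `v_i = 𝟙_{[-c,c]} g_i` with
  `g_i ∈ C²` of parity `σ`; their form-domain membership, window images and representation formula are discharged.
* `gc_even_gapShape_of_deflCert_wK` — copy of `dt_weilEvenGroundEnergy_ge_of_deflCert_w` (even sector, two-prime
  rank-one augmented certificate at level `β₂₃`, edge-only sliver `κ₂ ≥ (log 2)/2` on `|y| ≥ y₁`), with ONE change of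
  bookkeeping that lets a positivity cell's R-layer data be REUSED for a positive `λ`: the complement level is scaled,
  `n = (1 − θ)(β₂₃ − κ₂ 𝟙_E)`, so that any `λ ≤ θ (β₂₃ − κ₂)` is admissible with the weights
  `w = 1/((1 − θ)(β₂₃ − κ₂))` on the edge and `1/((1 − θ) β₂₃)` inside — the `λ = 0` weights of the cell divided by the
  constant `1 − θ`.  Conclusion: `λ ∫|φ|² ≤ Re Q(φ) + K |Σ_l c_l ∫ φ v̄_l|²` for every even window test `φ` on `[-c, c]`.

References: A. Weinstein, W. Stenger (1972) Ch. 5 §9; E. Bombieri, Rend. Mat. Acc. Lincei (9) 11 (2000) Thm 2, §4;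
H. Yoshida, Adv. Stud. Pure Math. 21 (1992) Thm 1.  Prover B, speedrun unit `sr-gb-rung-b` (gen 17).
-/

set_option linter.dupNamespace false

noncomputable section

open MeasureTheory Set Filter
open scoped Topology ENNReal NNReal ComplexConjugate BigOperators

namespace Summit.RiemannHypothesis.RiemannHypothesis.Theorems.PolarPerronFrobenius

open Literature.NumberTheory.LFunctions Literature.NumberTheory.LFunctions.ConnesVanSuijlekom
open Summit.RiemannHypothesis.RiemannHypothesis.Theorems.EvenWinsBeyondArch
open Summit.RiemannHypothesis.RiemannHypothesis.Theorems.OddSector (weilDirichletEnergy₂ weilPoleForm₂)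

/-! ## `C²` × indicator Ritz data -/

/-- **The penalised weighted deflated Temple bound from `C²` × indicator Ritz data, parity `σ`** (copy of
`dt_sector_bound_of_ritz_w` over `gc_sector_bound_wK`): for every smooth test `φ` on `[-c, c]` of parity `σ`,
`λ ∫|φ|² ≤ Re Q(φ) + K |Σ_l c_l ∫ φ v̄_l|²`. [cite: WeinsteinStenger1972, Ch. 5 §9 eq. (2) (k = 1: Temple's formula)] -/
theorem gc_sector_bound_of_ritz_wK {c : ℝ} (hc : 0 < c) (σ : ℝ) {k : ℕ}
    (g : Fin k → ℝ → ℝ) (hg : ∀ i, ContDiff ℝ 2 (g i)) (hgp : ∀ i x, g i (-x) = σ * g i x)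
    (v F : Fin k → ℝ → ℂ) (hv : ∀ i x, v i x = (((Icc (-c) c).indicator (g i) x : ℝ) : ℂ))
    (hF : ∀ i y, F i y = (Icc (-c) c).indicator (fun y ↦
        2 * (∫ x, v i x * (Real.cosh (x / 2) : ℂ)) * (Real.cosh (y / 2) : ℂ) -
          2 * (∫ x, v i x * (Real.sinh (x / 2) : ℂ)) * (Real.sinh (y / 2) : ℂ) +
        (∑ n ∈ weilPrimeIndex c, (((ArithmeticFunction.vonMangoldt n : ℝ) / Real.sqrt n : ℝ) : ℂ) *
          (2 * v i y - v i (y - Real.log n) - v i (y + Real.log n))) +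
        ∫ t in Ioi 0, (weilArchDensity t : ℂ) * (2 * v i y - v i (y - t) - v i (y + t))) y -
      (weilMarkovConstant c : ℂ) * v i y)
    (W : Fin k → Fin k → ℝ) (μ : Fin k → ℝ) (lam : ℝ) (hμ : ∀ i, 0 ≤ μ i) (K : ℝ) (cv : Fin k → ℝ)
    {n w : ℝ → ℝ} (hnm : Measurable n) (hwm : Measurable w) {C : ℝ} (hnC : ∀ y, |n y| ≤ C) (hwC : ∀ y, |w y| ≤ C)
    (hn0 : ∀ y, 0 ≤ n y) (hw0 : ∀ y, 0 ≤ w y) (hwn : ∀ y, w y * n y = 1)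
    (hcert : ∀ φ : ℝ → ℂ, IsWeilTest φ → tsupport φ ⊆ Icc (-c) c → (∀ x, φ (-x) = (σ : ℂ) * φ x) →
      (∫ y, n y * ‖φ y‖ ^ 2) + lam * ∫ x, ‖φ x‖ ^ 2 ≤
        (weilQuadratic φ).re + ∑ i, μ i * ‖∫ x, φ x * conj (v i x)‖ ^ 2)
    (hPSD : ∀ α : Fin k → ℝ, 0 ≤ ∑ i, ∑ j, α i * α j *
      ((weilPoleForm₂ (v i) (v j) + weilDirichletEnergy₂ c (v i) (v j) -
          weilMarkovConstant c * ∫ x, (v i x * conj (v j x)).re) - lam * (∫ x, (v i x * conj (v j x)).re) -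
        (∫ y, w y * ((F i - ∑ l, W i l • v l) y * conj ((F j - ∑ l, W j l • v l) y)).re) +
        K * ((∑ l, cv l * ∫ x, (v l x * conj (v i x)).re) * (∑ l, cv l * ∫ x, (v l x * conj (v j x)).re))))
    {φ : ℝ → ℂ} (hφ : IsWeilTest φ) (hφs : tsupport φ ⊆ Icc (-c) c) (hφp : ∀ x, φ (-x) = (σ : ℂ) * φ x) :
    lam * ∫ x, ‖φ x‖ ^ 2 ≤ (weilQuadratic φ).re + K * ‖∑ l, (cv l : ℂ) * ∫ x, φ x * conj (v l x)‖ ^ 2 := by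
  -- adapted from EvenWinsBeyondArch.dt_sector_bound_of_ritz_w
  have hveq : ∀ i, v i = fun x ↦ (((Icc (-c) c).indicator (g i) x : ℝ) : ℂ) := fun i ↦ funext (hv i)
  have hvD : ∀ i, MemLp (v i) 2 ∧ (∀ x, x ∉ Icc (-c) c → v i x = 0) ∧ (∀ x, (v i x).im = 0) ∧
      (∀ x, v i (-x) = (σ : ℂ) * v i x) ∧
      IntegrableOn (fun t ↦ weilArchDensity t * weilIncrement (v i) t) (Ioi 0) := by
    intro i
    obtain ⟨h1, h2, h3, h4⟩ := dt_indicator_mul_mem_formDomain hc ((hg i).of_le (by norm_num))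
    refine ⟨by rw [hveq i]; exact h1, fun x hx ↦ by rw [hv i x]; exact h2 x hx,
      fun x ↦ by rw [hv i x]; exact h3 x, fun x ↦ ?_, by rw [hveq i]; exact h4⟩
    rw [hv i, hv i]
    have hsym : (-x ∈ Icc (-c) c) ↔ (x ∈ Icc (-c) c) := by
      simp only [mem_Icc]; constructor <;> rintro ⟨h₁, h₂⟩ <;> constructor <;> linarith
    by_cases hx : x ∈ Icc (-c) c
    · rw [indicator_of_mem (hsym.2 hx), indicator_of_mem hx, hgp i x]; push_cast; ring
    · rw [indicator_of_notMem (fun h ↦ hx (hsym.1 h)), indicator_of_notMem hx]; simp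
  have hmaj : ∀ i, ∃ m : ℝ → ℝ, MemLp m 2 volume ∧
      (∀ y ∈ Ioo (-c) c,
        IntegrableOn (fun t ↦ weilArchDensity t * ‖2 * v i y - v i (y - t) - v i (y + t)‖) (Ioi 0)) ∧
      (∀ y ∈ Ioo (-c) c,
        ∫ t in Ioi 0, weilArchDensity t * ‖2 * v i y - v i (y - t) - v i (y + t)‖ ≤ m y) :=
    fun i ↦ dt_exists_majorant_of_contDiff hc (hg i) (hv i)
  have hFm : ∀ i, MemLp (F i) 2 := by
    intro i
    obtain ⟨m, hm, _, hHm⟩ := hmaj i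
    exact dt_windowImage_memLp (hvD i).1 hm hHm (hF i)
  have hrepr : ∀ i (f : ℝ → ℂ), MemLp f 2 → (∀ x, x ∉ Icc (-c) c → f x = 0) → (∀ x, (f x).im = 0) →
      (∀ x, f (-x) = (σ : ℂ) * f x) →
      IntegrableOn (fun t ↦ weilArchDensity t * weilIncrement f t) (Ioi 0) →
      weilPoleForm₂ (v i) f + weilDirichletEnergy₂ c (v i) f -
          weilMarkovConstant c * ∫ x, (v i x * conj (f x)).re = ∫ x, (F i x * conj (f x)).re := by
    intro i f hf hfs _ _ _
    obtain ⟨m, hm, hHi, hHm⟩ := hmaj i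
    exact dt_windowImage_repr (hvD i).1 hm hHi hHm (hF i) hf hfs
  exact gc_sector_bound_wK hc σ v F W μ lam hμ K cv hnm hwm hnC hwC hn0 hw0 hwn hvD hFm hrepr hcert hPSD hφ hφs hφp

/-! ## The two-prime certificate bridge, even sector, scaled complement level -/

/-- **Gap certificate in deflation shape from an even-sector two-prime certificate** (copy of
`dt_weilEvenGroundEnergy_ge_of_deflCert_w`, conclusion per test, complement level scaled by `1 − θ`).  Window
`0 < c ≤ a₀`, `c ≤ (log 5)/2`; certificate `hcert23` at level `β₂₃` on the even tests of `[-a₀, a₀]` with even penalty data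
`R` of non-negative weights; trial vectors `v_i = 𝟙_{[-c,c]} · maskPoly (R_i) n a₀` with explicit window images; any `W`;
`κ₂ ≥ (log 2)/2` with `κ₂ < β₂₃`; `0 ≤ θ < 1` and `λ ≤ θ (β₂₃ − κ₂)`; edge threshold `y₁ ≤ log 4 − c`; a real `K`,
coefficients `c_l`; and the penalised weighted kernel datum `A − λG − R_w + K d dᵀ ⪰ 0` with
`w = 1/((1−θ)(β₂₃ − κ₂))` on `|y| ≥ y₁`, `1/((1−θ)β₂₃)` inside.  Then every even window test `φ` on `[-c, c]` has
`λ ∫|φ|² ≤ Re Q(φ) + K |Σ_l c_l ∫ φ v̄_l|²`. [folklore] -/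
theorem gc_even_gapShape_of_deflCert_wK {c : ℝ} (hc : 0 < c) (hc5 : c ≤ Real.log 5 / 2)
    {a₀ : ℝ} (hca : c ≤ a₀) (R : List (ℚ × ℕ × List ℚ)) (n : ℕ) {β₂₃ : ℝ}
    (hReven : ∀ i : Fin R.length, (R.get i).2.1 % 2 = 0) (hRμ : ∀ i : Fin R.length, 0 ≤ (R.get i).1)
    (hcert23 : ∀ g : ℝ → ℂ, IsWeilTest g → tsupport g ⊆ Icc (-a₀) a₀ → (∀ x, g (-x) = g x) →
      β₂₃ * weilNorm2Sq g ≤ weilTwoPrimeQuadratic g +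
        (R.map fun r ↦ (r.1 : ℝ) * ‖∑ k ∈ Finset.range n, ((maskV r k : ℚ) : ℂ) * weilMoment a₀ g k‖ ^ 2).sum)
    (v F : Fin R.length → ℝ → ℂ)
    (hv : ∀ i x, v i x = (((Icc (-c) c).indicator (fun x ↦ maskPoly (R.get i) n a₀ x) x : ℝ) : ℂ))
    (hF : ∀ i y, F i y = (Icc (-c) c).indicator (fun y ↦
        2 * (∫ x, v i x * (Real.cosh (x / 2) : ℂ)) * (Real.cosh (y / 2) : ℂ) -
          2 * (∫ x, v i x * (Real.sinh (x / 2) : ℂ)) * (Real.sinh (y / 2) : ℂ) +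
        (∑ m ∈ weilPrimeIndex c, (((ArithmeticFunction.vonMangoldt m : ℝ) / Real.sqrt m : ℝ) : ℂ) *
          (2 * v i y - v i (y - Real.log m) - v i (y + Real.log m))) +
        ∫ t in Ioi 0, (weilArchDensity t : ℂ) * (2 * v i y - v i (y - t) - v i (y + t))) y -
      (weilMarkovConstant c : ℂ) * v i y)
    (W : Fin R.length → Fin R.length → ℝ) {κ₂ : ℝ} (hκ : Real.log 2 / 2 ≤ κ₂) (hκβ : κ₂ < β₂₃)
    {θ : ℝ} (hθ : 0 ≤ θ) (hθ1 : θ < 1) {lam : ℝ} (hlam : lam ≤ θ * (β₂₃ - κ₂))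
    {y₁ : ℝ} (hy : y₁ ≤ Real.log 4 - c) (K : ℝ) (cv : Fin R.length → ℝ)
    (hPSD : ∀ α : Fin R.length → ℝ, 0 ≤ ∑ i, ∑ j, α i * α j *
      ((weilPoleForm₂ (v i) (v j) + weilDirichletEnergy₂ c (v i) (v j) -
          weilMarkovConstant c * ∫ x, (v i x * conj (v j x)).re) - lam * (∫ x, (v i x * conj (v j x)).re) -
        (∫ y, {u : ℝ | y₁ ≤ |u|}.piecewise (fun _ ↦ 1 / ((1 - θ) * (β₂₃ - κ₂))) (fun _ ↦ 1 / ((1 - θ) * β₂₃)) y *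
          ((F i - ∑ l, W i l • v l) y * conj ((F j - ∑ l, W j l • v l) y)).re) +
        K * ((∑ l, cv l * ∫ x, (v l x * conj (v i x)).re) * (∑ l, cv l * ∫ x, (v l x * conj (v j x)).re))))
    {φ : ℝ → ℂ} (hφ : IsWeilTest φ) (hφs : tsupport φ ⊆ Icc (-c) c) (hφe : ∀ x, φ (-x) = φ x) :
    lam * ∫ x, ‖φ x‖ ^ 2 ≤ (weilQuadratic φ).re + K * ‖∑ l, (cv l : ℂ) * ∫ x, φ x * conj (v l x)‖ ^ 2 := by
  -- adapted from EvenWinsBeyondArch.dt_weilEvenGroundEnergy_ge_of_deflCert_w (complement level scaled by 1 − θ)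
  have hE : MeasurableSet {u : ℝ | y₁ ≤ |u|} := measurableSet_le measurable_const continuous_abs.measurable
  set nE : ℝ := (1 - θ) * (β₂₃ - κ₂) with hnE
  set nI : ℝ := (1 - θ) * β₂₃ with hnI
  have h1θ : 0 < 1 - θ := by linarith
  have hlog : 0 ≤ Real.log 2 / 2 := by positivity
  have hκ0 : 0 ≤ κ₂ := hlog.trans hκ
  have hnE0 : 0 < nE := by rw [hnE]; exact mul_pos h1θ (by linarith)
  have hnI0 : 0 < nI := by rw [hnI]; exact mul_pos h1θ (by linarith)
  have hnEI : nE ≤ nI := by rw [hnE, hnI]; nlinarith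
  set C : ℝ := nI + 1 / nE with hC
  have hpw : ∀ (a b : ℝ) (y : ℝ), {u : ℝ | y₁ ≤ |u|}.piecewise (fun _ ↦ a) (fun _ ↦ b) y = a ∨
      {u : ℝ | y₁ ≤ |u|}.piecewise (fun _ ↦ a) (fun _ ↦ b) y = b := by
    intro a b y
    by_cases hy' : y ∈ {u : ℝ | y₁ ≤ |u|}
    · exact Or.inl (Set.piecewise_eq_of_mem _ _ _ hy')
    · exact Or.inr (Set.piecewise_eq_of_notMem _ _ _ hy')
  have hmeas : ∀ a b : ℝ, Measurable ({u : ℝ | y₁ ≤ |u|}.piecewise (fun _ ↦ a) (fun _ ↦ b)) := fun a b ↦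
    Measurable.piecewise hE measurable_const measurable_const
  refine gc_sector_bound_of_ritz_wK hc 1 (fun i x ↦ maskPoly (R.get i) n a₀ x)
    (fun i ↦ contDiff_maskPoly (R.get i) n a₀) (fun i x ↦ by
      rw [maskPoly_neg_of_even (R.get i) (hReven i) n a₀ x]; ring)
    v F hv hF W (fun i ↦ ((R.get i).1 : ℝ)) lam (fun i ↦ by exact_mod_cast hRμ i) K cv
    (n := {u : ℝ | y₁ ≤ |u|}.piecewise (fun _ ↦ nE) (fun _ ↦ nI))
    (w := {u : ℝ | y₁ ≤ |u|}.piecewise (fun _ ↦ 1 / nE) (fun _ ↦ 1 / nI)) (C := C)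
    (hmeas _ _) (hmeas _ _) ?_ ?_ ?_ ?_ ?_ ?_ hPSD hφ hφs (fun x ↦ by simpa using hφe x)
  · intro y
    have h1 : 0 ≤ 1 / nE := by positivity
    rcases hpw nE nI y with h | h <;> rw [h]
    · rw [abs_of_pos hnE0, hC]; linarith
    · rw [abs_of_pos hnI0, hC]; linarith
  · intro y
    have h1 : 1 / nI ≤ 1 / nE := one_div_le_one_div_of_le hnE0 hnEI
    rcases hpw (1 / nE) (1 / nI) y with h | h <;> rw [h]
    · rw [abs_of_pos (by positivity), hC]; linarith [hnI0.le]
    · rw [abs_of_pos (by positivity), hC]; linarith [hnI0.le]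
  · intro y; rcases hpw nE nI y with h | h <;> rw [h] <;> positivity
  · intro y; rcases hpw (1 / nE) (1 / nI) y with h | h <;> rw [h] <;> positivity
  · intro y
    by_cases hy' : y ∈ {u : ℝ | y₁ ≤ |u|}
    · rw [Set.piecewise_eq_of_mem _ _ _ hy', Set.piecewise_eq_of_mem _ _ _ hy']; field_simp
    · rw [Set.piecewise_eq_of_notMem _ _ _ hy', Set.piecewise_eq_of_notMem _ _ _ hy']; field_simp
  · -- the scaled weighted certificate on smooth even tests
    intro ψ hψ hψs hψp
    have hψe : ∀ x, ψ (-x) = ψ x := fun x ↦ by simpa using hψp x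
    have hψa : tsupport ψ ⊆ Icc (-a₀) a₀ := hψs.trans (Icc_subset_Icc (by linarith) hca)
    have h23 := hcert23 ψ hψ hψa hψe
    have hsl := dt_weilTwoPrimeQuadratic_sub_edge_le_weilQuadratic_re hψ hψs hc5 hy
    have hsum : (R.map fun r ↦ (r.1 : ℝ) * ‖∑ k ∈ Finset.range n, ((maskV r k : ℚ) : ℂ) * weilMoment a₀ ψ k‖ ^ 2).sum =
        ∑ i : Fin R.length, ((R.get i).1 : ℝ) * ‖∫ x, ψ x * conj (v i x)‖ ^ 2 := by
      rw [dt_list_sum_map_eq_sum_get]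
      refine Finset.sum_congr rfl fun i _ ↦ ?_
      rw [dt_rankOne_term_eq (R.get i) n a₀ hψ hψs]
      simp only [hv i]
    have hnorm : weilNorm2Sq ψ = ∫ x, ‖ψ x‖ ^ 2 := rfl
    have h2 : Integrable fun u : ℝ ↦ ‖ψ u‖ ^ 2 := hψ.integrable_norm_sq
    have hn_int : (∫ y, {u : ℝ | y₁ ≤ |u|}.piecewise (fun _ ↦ nE) (fun _ ↦ nI) y * ‖ψ y‖ ^ 2) =
        nI * (∫ y, ‖ψ y‖ ^ 2) + (nE - nI) * ∫ y, {u : ℝ | y₁ ≤ |u|}.indicator (fun u ↦ ‖ψ u‖ ^ 2) y :=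
      dt_integral_piecewise_mul hE nE nI h2
    have hEI : nE - nI = -((1 - θ) * κ₂) := by rw [hnE, hnI]; ring
    rw [hsum, hnorm] at h23
    rw [hn_int, hEI, hnI]
    -- `0 ≤ X ≤ ∫|ψ|²` for the edge mass `X`
    set X : ℝ := ∫ y, {u : ℝ | y₁ ≤ |u|}.indicator (fun u ↦ ‖ψ u‖ ^ 2) y with hX
    set N2 : ℝ := ∫ y, ‖ψ y‖ ^ 2 with hN2
    have hX0 : 0 ≤ X := integral_nonneg fun y ↦ Set.indicator_nonneg (fun _ _ ↦ by positivity) y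
    have hXN : X ≤ N2 := by
      refine integral_mono (h2.indicator hE) h2 fun y ↦ ?_
      exact Set.indicator_le_self' (fun _ _ ↦ by positivity) y
    have hN0 : 0 ≤ N2 := integral_nonneg fun y ↦ by positivity
    have hκX := mul_le_mul_of_nonneg_right hκ hX0
    -- `λ N2 ≤ θ β₂₃ N2 − θ κ₂ X`
    have hlamN : lam * N2 ≤ θ * (β₂₃ - κ₂) * N2 := mul_le_mul_of_nonneg_right hlam hN0
    have hθκ : θ * κ₂ * X ≤ θ * κ₂ * N2 := mul_le_mul_of_nonneg_left hXN (mul_nonneg hθ hκ0)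
    nlinarith [h23, hsl, hκX, hlamN, hθκ, hX0, hN0, hθ, hκ0]

end Summit.RiemannHypothesis.RiemannHypothesis.Theorems.PolarPerronFrobenius

end
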